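import Literature.NumberTheory.LFunctions.SelbergShortIntervalDensity
import Literature.NumberTheory.LFunctions.ZetaZeroOrdinateSums
import HarnessLib

/-!
# The density input for the `L¹` theory of `S(t+h) − S(t)`: `∑_{T/2<γ≤5T/2} m(ρ) δ_ρ e^{τδ_ρ/4} ≪ T`

Topic `Literature/NumberTheory/LFunctions`. Everything in this file is PROVED (no definitions, no
named facts).

The off-line zeros enter the `L¹` bound of the smoothed `S(t+h) − S(t)` (`SelbergDeltaOffLine.lean`)
through the finite sum `∑_{T/2 < γ ≤ 5T/2} m(ρ) δ_ρ e^{τ δ_ρ/4}`, `δ_ρ = |β − 1/2|`, `τ = (log T)/M''`.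
Selberg's density theorem near the critical line in short windows
(`Literature.NumberTheory.LFunctions.TwistedMoment.sum_zetaZeroOrder_le_of_meanSquare`, with the
critical-line mean square `…meanSquare_zetaMollifierG_half_le`) bounds the zeros with
`δ_ρ ≥ a/log T` in a window of length `≍ V` by `≪ V (log T/a) e^{-κ a}` plus lower-order terms; covering
`(T/2, 5T/2]` by `≍ T/V` overlapping windows, reflecting the zeros to the left of the line
(`ρ ↦ 1 − ρ̄`), and summing over the levels `a` gives `O(T)` once `M''` is large compared with
`1/κ` (this file: the combinatorial skeleton `sum_weight_le_of_levels`, the covering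
`sum_le_of_blocks`, the reflection `sum_left_eq_sum_reflect`, and the assembled bound
`nearSum_le`).

## References

* A. Selberg, *Contributions to the theory of the Riemann zeta-function* (1946), Thm. 1 and §§5–7.
* E. C. Titchmarsh, *The Theory of the Riemann Zeta-Function*, 2nd ed. (1986), Thm. 9.19 (C),
  §9.26. [cite: Titchmarsh1986, §9.26]
-/

noncomputable section

open Complex Real MeasureTheory Set Filter Finset
open scoped ComplexConjugate

namespace Literature.NumberTheory.LFunctions.SelbergDelta

open Literature.NumberTheory.LFunctions.TwistedMoment
open Literature.NumberTheory.LFunctions.ZeroOrdinateSums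

/-! ### Covering `(T/2, 5T/2]` by overlapping windows -/

/-- **Covering by blocks.** Let `V' > 0`, `J = ⌈2T/V'⌉`. Every `γ ∈ (T/2, 5T/2]` lies strictly inside the
window `(T/2 + (j−1)V', T/2 + (j+1)V')` with `j = ⌈(γ − T/2)/V'⌉ ∈ [1, J]`. Hence, if a non-negative
weight `m` summed over any finite set of the zeros `Z` lying in one window (and satisfying a
property `P`) is at most `D`, then over all of `Z` it is at most `J·D`. [folklore] -/
theorem sum_le_of_blocks {T V' D : ℝ} (hV' : 0 < V') {P : ℂ → Prop} {m : ℂ → ℝ}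
    (hblock : ∀ j : ℕ, 1 ≤ j → (j : ℝ) ≤ ⌈2 * T / V'⌉₊ → ∀ Z₀ : Finset ℂ,
      (∀ ρ ∈ Z₀, P ρ ∧ T / 2 + ((j : ℝ) - 1) * V' < ρ.im ∧ ρ.im < T / 2 + ((j : ℝ) + 1) * V') →
      ∑ ρ ∈ Z₀, m ρ ≤ D)
    (Z : Finset ℂ) (hZ : ∀ ρ ∈ Z, P ρ ∧ T / 2 < ρ.im ∧ ρ.im ≤ 5 * T / 2) :
    ∑ ρ ∈ Z, m ρ ≤ (⌈2 * T / V'⌉₊ : ℝ) * D := by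
  set J := ⌈2 * T / V'⌉₊ with hJ
  set idx : ℂ → ℕ := fun ρ => ⌈(ρ.im - T / 2) / V'⌉₊ with hidx
  have hidx_mem : ∀ ρ ∈ Z, idx ρ ∈ Finset.Icc 1 J := by
    intro ρ hρ
    obtain ⟨-, h1, h2⟩ := hZ ρ hρ
    rw [Finset.mem_Icc]
    constructor
    · exact Nat.one_le_iff_ne_zero.2 (Nat.pos_iff_ne_zero.1 (Nat.ceil_pos.2 (div_pos (sub_pos.2 h1) hV')))
    · exact Nat.ceil_mono (div_le_div_of_nonneg_right (by linarith) hV'.le)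
  have hwin : ∀ ρ ∈ Z, T / 2 + ((idx ρ : ℝ) - 1) * V' < ρ.im ∧ ρ.im < T / 2 + ((idx ρ : ℝ) + 1) * V' := by
    intro ρ hρ
    obtain ⟨-, h1, _⟩ := hZ ρ hρ
    have hpos : 0 < (ρ.im - T / 2) / V' := div_pos (by linarith) hV'
    have hc1 := Nat.ceil_lt_add_one hpos.le    -- idx < x + 1
    have hc2 := Nat.le_ceil ((ρ.im - T / 2) / V') -- x ≤ idx
    simp only [hidx]
    constructor
    · have : ((⌈(ρ.im - T / 2) / V'⌉₊ : ℝ) - 1) * V' < (ρ.im - T / 2) / V' * V' := by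
        exact mul_lt_mul_of_pos_right (by linarith) hV'
      rw [div_mul_cancel₀ _ hV'.ne'] at this; linarith
    · have : (ρ.im - T / 2) / V' * V' < ((⌈(ρ.im - T / 2) / V'⌉₊ : ℝ) + 1) * V' :=
        mul_lt_mul_of_pos_right (by linarith) hV'
      rw [div_mul_cancel₀ _ hV'.ne'] at this; linarith
  calc ∑ ρ ∈ Z, m ρ = ∑ j ∈ Finset.Icc 1 J, ∑ ρ ∈ Z.filter (fun ρ => idx ρ = j), m ρ :=
        (Finset.sum_fiberwise_of_maps_to hidx_mem _).symm
    _ ≤ ∑ j ∈ Finset.Icc 1 J, D := by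
        refine Finset.sum_le_sum fun j hj => ?_
        rw [Finset.mem_Icc] at hj
        refine hblock j hj.1 (by exact_mod_cast hj.2) _ fun ρ hρ => ?_
        rw [Finset.mem_filter] at hρ
        obtain ⟨hw1, hw2⟩ := hwin ρ hρ.1
        rw [hρ.2] at hw1 hw2
        exact ⟨(hZ ρ hρ.1).1, hw1, hw2⟩
    _ = (J : ℝ) * D := by
        rw [Finset.sum_const, Nat.card_Icc, nsmul_eq_mul]
        simp

/-! ### Reflection of the zeros to the left of the line -/

/-- **The zeros on the left are the reflections of zeros on the right.** For a finite set `Z` of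
zeros of `ζ` with `0 < β ≤ 1/2 − η` (`η ≥ 0`), the multiplicities summed over `Z` equal those summed
over the reflected set `{1 − ρ̄}`, which consists of zeros with `β ≥ 1/2 + η` and the same ordinates.
[folklore] -/
theorem sum_left_eq_sum_reflect (Z : Finset ℂ)
    (hZ : ∀ ρ ∈ Z, riemannZeta ρ = 0 ∧ 0 < ρ.re ∧ ρ.re < 1) :
    ∑ ρ ∈ Z, (riemannZetaZeroOrder ρ : ℝ) = ∑ ρ ∈ Z.image (fun ρ => 1 - conj ρ), (riemannZetaZeroOrder ρ : ℝ) := by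
  have hinj : Set.InjOn (fun ρ : ℂ => 1 - conj ρ) Z := by
    intro a _ b _ hab
    have := congrArg (fun z => conj (1 - z)) hab
    simpa using this
  rw [Finset.sum_image hinj]
  refine Finset.sum_congr rfl fun ρ hρ => ?_
  obtain ⟨_, h0, h1⟩ := hZ ρ hρ
  rw [riemannZetaZeroOrder_one_sub_conj h0 h1]

/-- Membership of the reflected zeros. [folklore] -/
theorem reflect_mem {ρ : ℂ} (hz : riemannZeta ρ = 0) (h0 : 0 < ρ.re) {η c d : ℝ}
    (hβ : ρ.re ≤ 1 / 2 - η) (hc : c < ρ.im) (hd : ρ.im < d) :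
    riemannZeta (1 - conj ρ) = 0 ∧ 1 / 2 + η ≤ (1 - conj ρ).re ∧ c < (1 - conj ρ).im ∧ (1 - conj ρ).im < d := by
  have hmem := ZetaZeros.riemannZetaNontrivialZeros.one_sub_conj_mem
    (ZetaZeros.riemannZetaNontrivialZeros.mem_of_re_pos hz h0)
  refine ⟨ZetaZeros.riemannZetaNontrivialZeros.zeta_eq_zero hmem, ?_, ?_, ?_⟩
  · simp; linarith
  · simpa using hc
  · simpa using hd

/-! ### The level decomposition -/

/-- **Level decomposition.** Let `F` be a finite set of zeros of `ζ` in the critical strip, `L > 0`,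
`0 < τ ≤ L/M''` (`M'' > 0`). With `δ_ρ = |β − 1/2|` and the level `a(ρ) = ⌊δ_ρ L⌋`,
`∑_{ρ∈F} m(ρ) δ_ρ e^{τδ_ρ/4} ≤ ∑_{a=0}^{⌊L/2⌋} ((a+1)/L) e^{(a+1)/(4M'')} ∑_{ρ∈F, a(ρ)=a} m(ρ)`. [folklore] -/
theorem sum_weight_le_of_levels (F : Finset ℂ) (hF : ∀ ρ ∈ F, riemannZeta ρ = 0 ∧ 0 < ρ.re ∧ ρ.re < 1)
    {Lg M'' τ : ℝ} (hL : 0 < Lg) (hM : 0 < M'') (hτ : τ ≤ Lg / M'') :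
    ∑ ρ ∈ F, (riemannZetaZeroOrder ρ : ℝ) * (|ρ.re - 1 / 2| * Real.exp (τ * |ρ.re - 1 / 2| / 4)) ≤
      ∑ a ∈ Finset.range (⌊Lg / 2⌋₊ + 1), (((a : ℝ) + 1) / Lg * Real.exp (((a : ℝ) + 1) / (4 * M''))) *
        ∑ ρ ∈ F.filter (fun ρ => ⌊|ρ.re - 1 / 2| * Lg⌋₊ = a), (riemannZetaZeroOrder ρ : ℝ) := by
  set lev : ℂ → ℕ := fun ρ => ⌊|ρ.re - 1 / 2| * Lg⌋₊ with hlev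
  have hlev_mem : ∀ ρ ∈ F, lev ρ ∈ Finset.range (⌊Lg / 2⌋₊ + 1) := by
    intro ρ hρ
    obtain ⟨_, h0, h1⟩ := hF ρ hρ
    have hd12 : |ρ.re - 1 / 2| ≤ 1 / 2 := abs_le.2 ⟨by linarith, by linarith⟩
    rw [Finset.mem_range, Nat.lt_add_one_iff]
    exact Nat.floor_le_floor (by nlinarith)
  rw [← Finset.sum_fiberwise_of_maps_to hlev_mem]
  refine Finset.sum_le_sum fun a _ => ?_
  rw [Finset.mul_sum]
  refine Finset.sum_le_sum fun ρ hρ => ?_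
  rw [Finset.mem_filter] at hρ
  obtain ⟨hz, h0, h1⟩ := hF ρ hρ.1
  have hm : (0 : ℝ) ≤ riemannZetaZeroOrder ρ := riemannZetaZeroOrder_nonneg_of_zero hz
  rw [mul_comm (((a : ℝ) + 1) / Lg * Real.exp (((a : ℝ) + 1) / (4 * M'')))]
  refine mul_le_mul_of_nonneg_left ?_ hm
  set dρ := |ρ.re - 1 / 2| with hdρ
  have hd0 : 0 ≤ dρ := abs_nonneg _
  -- `dρ Lg < a + 1`
  have hdL : dρ * Lg < (a : ℝ) + 1 := by
    have := Nat.lt_floor_add_one (dρ * Lg)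
    rw [show ⌊dρ * Lg⌋₊ = a from hρ.2] at this
    exact_mod_cast this
  have hdle : dρ ≤ ((a : ℝ) + 1) / Lg := by rw [le_div_iff₀ hL]; exact hdL.le
  have hexp : Real.exp (τ * dρ / 4) ≤ Real.exp (((a : ℝ) + 1) / (4 * M'')) := by
    refine Real.exp_le_exp.2 ?_
    have h1 : τ * dρ ≤ Lg / M'' * dρ := mul_le_mul_of_nonneg_right hτ hd0
    have h2 : Lg / M'' * dρ ≤ Lg / M'' * (((a : ℝ) + 1) / Lg) := mul_le_mul_of_nonneg_left hdle (by positivity)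
    have e : Lg / M'' * (((a : ℝ) + 1) / Lg) = ((a : ℝ) + 1) / M'' := by field_simp
    rw [e] at h2
    have : τ * dρ / 4 ≤ ((a : ℝ) + 1) / M'' / 4 := by linarith
    rw [show ((a : ℝ) + 1) / (4 * M'') = ((a : ℝ) + 1) / M'' / 4 by field_simp]
    exact this
  exact mul_le_mul hdle hexp (Real.exp_pos _).le (by positivity)

/-! ### The near sum in terms of a right-half density bound -/

/-- **The near sum against a density bound.** Let `F` be a finite set of zeros of `ζ` in the strip
with `T/2 < γ ≤ 5T/2`, `L > 0`, `M'' > 0`, `τ ≤ L/M''`. Suppose `∑_{ρ∈F} m(ρ) ≤ N₀` and, for every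
level `a ≥ 1`, every finite set `Z` of zeros with `β ≥ 1/2 + a/L`, `T/2 < γ ≤ 5T/2` has
`∑_{Z} m ≤ D(a)`. Then
`∑_{ρ∈F} m(ρ) δ_ρ e^{τδ_ρ/4} ≤ e^{1/(4M'')} N₀/L + 2 ∑_{a=1}^{⌊L/2⌋} ((a+1)/L) e^{(a+1)/(4M'')} D(a)`
(the zeros to the left of the line are reflected). [folklore] -/
theorem nearSum_le_of_density {T Lg M'' τ N₀ : ℝ} {D : ℕ → ℝ} (hL : 0 < Lg) (hM : 0 < M'') (hτ : τ ≤ Lg / M'')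
    (F : Finset ℂ) (hF : ∀ ρ ∈ F, riemannZeta ρ = 0 ∧ 0 < ρ.re ∧ ρ.re < 1 ∧ T / 2 < ρ.im ∧ ρ.im ≤ 5 * T / 2)
    (hN₀ : ∑ ρ ∈ F, (riemannZetaZeroOrder ρ : ℝ) ≤ N₀)
    (hD : ∀ a : ℕ, 1 ≤ a → ∀ Z : Finset ℂ,
      (∀ ρ ∈ Z, riemannZeta ρ = 0 ∧ 1 / 2 + (a : ℝ) / Lg ≤ ρ.re ∧ T / 2 < ρ.im ∧ ρ.im ≤ 5 * T / 2) →
      ∑ ρ ∈ Z, (riemannZetaZeroOrder ρ : ℝ) ≤ D a) :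
    ∑ ρ ∈ F, (riemannZetaZeroOrder ρ : ℝ) * (|ρ.re - 1 / 2| * Real.exp (τ * |ρ.re - 1 / 2| / 4)) ≤
      Real.exp (1 / (4 * M'')) * N₀ / Lg +
        2 * ∑ a ∈ Finset.Icc 1 ⌊Lg / 2⌋₊, ((a : ℝ) + 1) / Lg * Real.exp (((a : ℝ) + 1) / (4 * M'')) * D a := by
  have hF' : ∀ ρ ∈ F, riemannZeta ρ = 0 ∧ 0 < ρ.re ∧ ρ.re < 1 := fun ρ hρ => ⟨(hF ρ hρ).1, (hF ρ hρ).2.1, (hF ρ hρ).2.2.1⟩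
  refine (sum_weight_le_of_levels F hF' hL hM hτ).trans ?_
  have hm : ∀ ρ ∈ F, (0 : ℝ) ≤ riemannZetaZeroOrder ρ := fun ρ hρ => riemannZetaZeroOrder_nonneg_of_zero (hF ρ hρ).1
  rw [Finset.range_eq_Ico, ← Finset.sum_Ico_consecutive _ (Nat.zero_le 1) (by omega : 1 ≤ ⌊Lg / 2⌋₊ + 1),
    Finset.sum_Ico_eq_sum_range, show 1 - 0 = 1 by rfl, Finset.sum_range_one]
  simp only [Nat.cast_zero, zero_add, add_zero]
  have hIco : Finset.Ico 1 (⌊Lg / 2⌋₊ + 1) = Finset.Icc 1 ⌊Lg / 2⌋₊ := by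
    ext a; simp [Finset.mem_Ico, Finset.mem_Icc]
  rw [hIco]
  have hlev : ∀ a ∈ Finset.Icc 1 ⌊Lg / 2⌋₊,
      ((a : ℝ) + 1) / Lg * Real.exp (((a : ℝ) + 1) / (4 * M'')) *
          ∑ ρ ∈ F.filter (fun ρ => ⌊|ρ.re - 1 / 2| * Lg⌋₊ = a), (riemannZetaZeroOrder ρ : ℝ) ≤
        2 * (((a : ℝ) + 1) / Lg * Real.exp (((a : ℝ) + 1) / (4 * M'')) * D a) := by
    intro a ha
    rw [Finset.mem_Icc] at ha
    have ha1 : (1 : ℝ) ≤ a := by exact_mod_cast ha.1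
    set S := F.filter (fun ρ => ⌊|ρ.re - 1 / 2| * Lg⌋₊ = a) with hS
    have hSδ : ∀ ρ ∈ S, (a : ℝ) / Lg ≤ |ρ.re - 1 / 2| := by
      intro ρ hρ
      rw [hS, Finset.mem_filter] at hρ
      rw [div_le_iff₀ hL]
      have := Nat.floor_le (mul_nonneg (abs_nonneg (ρ.re - 1 / 2)) hL.le)
      rw [hρ.2] at this
      exact this
    set SR := S.filter (fun ρ => 1 / 2 ≤ ρ.re) with hSR
    set SL := S.filter (fun ρ => ¬ 1 / 2 ≤ ρ.re) with hSL
    have hsplit : ∑ ρ ∈ S, (riemannZetaZeroOrder ρ : ℝ) = ∑ ρ ∈ SR, (riemannZetaZeroOrder ρ : ℝ) + ∑ ρ ∈ SL, (riemannZetaZeroOrder ρ : ℝ) :=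
      (Finset.sum_filter_add_sum_filter_not S (fun ρ => 1 / 2 ≤ ρ.re) _).symm
    have hR : ∑ ρ ∈ SR, (riemannZetaZeroOrder ρ : ℝ) ≤ D a := by
      refine hD a ha.1 SR fun ρ hρ => ?_
      rw [hSR, Finset.mem_filter] at hρ
      have hρS := hρ.1
      rw [hS, Finset.mem_filter] at hρS
      obtain ⟨hz, h0, h1, hγ1, hγ2⟩ := hF ρ hρS.1
      have hδ := hSδ ρ hρ.1
      rw [abs_of_nonneg (by linarith [hρ.2])] at hδ
      exact ⟨hz, by linarith, hγ1, hγ2⟩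
    have hLft : ∑ ρ ∈ SL, (riemannZetaZeroOrder ρ : ℝ) ≤ D a := by
      have hSL' : ∀ ρ ∈ SL, riemannZeta ρ = 0 ∧ 0 < ρ.re ∧ ρ.re < 1 := fun ρ hρ => by
        rw [hSL, Finset.mem_filter] at hρ
        have hρS := hρ.1; rw [hS, Finset.mem_filter] at hρS
        exact ⟨(hF ρ hρS.1).1, (hF ρ hρS.1).2.1, (hF ρ hρS.1).2.2.1⟩
      rw [sum_left_eq_sum_reflect SL hSL']
      refine hD a ha.1 _ fun w hw => ?_
      rw [Finset.mem_image] at hw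
      obtain ⟨ρ, hρ, rfl⟩ := hw
      have hρ' := hρ
      rw [hSL, Finset.mem_filter] at hρ'
      have hρS := hρ'.1; rw [hS, Finset.mem_filter] at hρS
      obtain ⟨hz, h0, h1, hγ1, hγ2⟩ := hF ρ hρS.1
      have hδ := hSδ ρ hρ'.1
      push Not at hρ'
      rw [abs_of_neg (by linarith [hρ'.2])] at hδ
      have hmem := reflect_mem hz h0 (η := (a : ℝ) / Lg) (c := T / 2) (d := 5 * T / 2 + 1) (by linarith) hγ1 (by linarith)
      refine ⟨hmem.1, hmem.2.1, hmem.2.2.1, ?_⟩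
      simpa using hγ2
    have h0 : 0 ≤ ((a : ℝ) + 1) / Lg * Real.exp (((a : ℝ) + 1) / (4 * M'')) := by positivity
    calc ((a : ℝ) + 1) / Lg * Real.exp (((a : ℝ) + 1) / (4 * M'')) * ∑ ρ ∈ S, (riemannZetaZeroOrder ρ : ℝ)
        ≤ ((a : ℝ) + 1) / Lg * Real.exp (((a : ℝ) + 1) / (4 * M'')) * (D a + D a) := by
          rw [hsplit]; exact mul_le_mul_of_nonneg_left (add_le_add hR hLft) h0
      _ = 2 * (((a : ℝ) + 1) / Lg * Real.exp (((a : ℝ) + 1) / (4 * M'')) * D a) := by ring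
  refine add_le_add ?_ ?_
  swap
  · rw [Finset.mul_sum]; exact Finset.sum_le_sum hlev
  · -- level `0`: all of `F`
    have hle : ∑ ρ ∈ F.filter (fun ρ => ⌊|ρ.re - 1 / 2| * Lg⌋₊ = 0), (riemannZetaZeroOrder ρ : ℝ) ≤ N₀ :=
      (Finset.sum_le_sum_of_subset_of_nonneg (Finset.filter_subset _ _) fun ρ hρ _ => hm ρ hρ).trans hN₀
    have h0 : 0 ≤ 1 / Lg * Real.exp (1 / (4 * M'')) := by positivity
    calc 1 / Lg * Real.exp (1 / (4 * M'')) * ∑ ρ ∈ F.filter (fun ρ => ⌊|ρ.re - 1 / 2| * Lg⌋₊ = 0), (riemannZetaZeroOrder ρ : ℝ)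
        ≤ 1 / Lg * Real.exp (1 / (4 * M'')) * N₀ := mul_le_mul_of_nonneg_left hle h0
      _ = Real.exp (1 / (4 * M'')) * N₀ / Lg := by ring

/-! ### The count of all near zeros -/

/-- **`∑_{T/2 < γ ≤ 5T/2} m(ρ) ≤ C_w (2T + 3) log(5T/2 + 3)`** (local counts of all the zeros).
[cite: MontgomeryVaughan2007, Thm. 10.13] -/
theorem sum_near_le {C : ℝ}
    (hC : ∀ (c : ℝ) (F : Finset ℂ), (∀ ρ ∈ F, ρ ∈ ZetaZeros.riemannZetaNontrivialZeros ∧ |ρ.im - c| ≤ 1 / 2) →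
      ∑ ρ ∈ F, (riemannZetaZeroOrder ρ : ℝ) ≤ C * Real.log (|c| + 2))
    {T : ℝ} (hT : 2 ≤ T) (F : Finset ℂ)
    (hF : ∀ ρ ∈ F, riemannZeta ρ = 0 ∧ 0 < ρ.re ∧ ρ.re < 1 ∧ T / 2 < ρ.im ∧ ρ.im ≤ 5 * T / 2) :
    ∑ ρ ∈ F, (riemannZetaZeroOrder ρ : ℝ) ≤ C * ((2 * T + 3) * Real.log (5 * T / 2 + 3)) := by
  have hC0 : 0 ≤ C := by
    have := hC 0 ∅ (by simp)
    simp at this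
    have hl : 0 < Real.log 2 := Real.log_pos (by norm_num)
    nlinarith
  have hF' : ∀ ρ ∈ F, ρ ∈ ZetaZeros.riemannZetaNontrivialZeros := fun ρ hρ =>
    ZetaZeros.riemannZetaNontrivialZeros.mem_of_re_pos (hF ρ hρ).1 (hF ρ hρ).2.1
  have h := sum_mul_le_of_ordinate_majorant hC (ψ := fun _ => (1 : ℝ)) (g := fun _ => (1 : ℝ)) (fun _ => zero_le_one) F hF'
    (fun _ _ => le_rfl)
  simp only [mul_one, one_mul] at h
  refine h.trans (mul_le_mul_of_nonneg_left ?_ hC0)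
  -- the rounded ordinates lie in `[⌊T/2⌋, ⌈5T/2⌉]`
  set K := F.image (fun ρ => round ρ.im) with hK
  have hKsub : K ⊆ Finset.Icc ⌊T / 2⌋ ⌈5 * T / 2⌉ := by
    intro k hk
    rw [hK, Finset.mem_image] at hk
    obtain ⟨ρ, hρ, rfl⟩ := hk
    obtain ⟨-, -, -, h1, h2⟩ := hF ρ hρ
    rw [Finset.mem_Icc, round_eq]
    constructor
    · exact Int.floor_le_floor (by linarith)
    · have h3 : ((⌊ρ.im + 1 / 2⌋ : ℤ) : ℝ) < ⌈5 * T / 2⌉ + 1 := by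
        have := Int.floor_le (ρ.im + 1 / 2); have := Int.le_ceil (5 * T / 2); linarith
      have h4 : ⌊ρ.im + 1 / 2⌋ < ⌈5 * T / 2⌉ + 1 := by exact_mod_cast h3
      omega
  have hlog : ∀ k ∈ K, Real.log (|(k : ℝ)| + 2) ≤ Real.log (5 * T / 2 + 3) := by
    intro k hk
    have hk' := hKsub hk
    rw [Finset.mem_Icc] at hk'
    refine Real.log_le_log (by positivity) ?_
    have h1 : (⌊T / 2⌋ : ℝ) ≤ k := by exact_mod_cast hk'.1
    have h2 : (k : ℝ) ≤ ⌈5 * T / 2⌉ := by exact_mod_cast hk'.2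
    have h3 : (0 : ℝ) ≤ k := le_trans (by have := Int.floor_nonneg.2 (show (0:ℝ) ≤ T / 2 by linarith); exact_mod_cast this) h1
    rw [abs_of_nonneg h3]
    linarith [Int.ceil_lt_add_one (5 * T / 2)]
  have hcard : (K.card : ℝ) ≤ 2 * T + 3 := by
    have h1 := Finset.card_le_card hKsub
    rw [Int.card_Icc] at h1
    have h2 : ((K.card : ℕ) : ℝ) ≤ ((⌈5 * T / 2⌉ + 1 - ⌊T / 2⌋).toNat : ℝ) := by exact_mod_cast h1
    refine h2.trans ?_
    have hnn : 0 ≤ ⌈5 * T / 2⌉ + 1 - ⌊T / 2⌋ := by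
      have h5 : ((⌊T / 2⌋ : ℤ) : ℝ) ≤ ⌈5 * T / 2⌉ := by
        have := Int.floor_le (T / 2); have := Int.le_ceil (5 * T / 2); linarith
      have h6 : ⌊T / 2⌋ ≤ ⌈5 * T / 2⌉ := by exact_mod_cast h5
      linarith
    have e : (((⌈5 * T / 2⌉ + 1 - ⌊T / 2⌋).toNat : ℕ) : ℝ) = ((⌈5 * T / 2⌉ + 1 - ⌊T / 2⌋ : ℤ) : ℝ) := by
      have := Int.toNat_of_nonneg hnn; exact_mod_cast this
    rw [e]; push_cast
    linarith [Int.ceil_lt_add_one (5 * T / 2), Int.lt_floor_add_one (T / 2)]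
  calc ∑ k ∈ K, Real.log (|(k : ℝ)| + 2) ≤ ∑ k ∈ K, Real.log (5 * T / 2 + 3) := Finset.sum_le_sum hlog
    _ = K.card * Real.log (5 * T / 2 + 3) := by rw [Finset.sum_const, nsmul_eq_mul]
    _ ≤ (2 * T + 3) * Real.log (5 * T / 2 + 3) :=
        mul_le_mul_of_nonneg_right hcard (Real.log_nonneg (by linarith))

/-! ### The density bound on one level, summed over the blocks -/

/-- **One level, all blocks.** Parameters: `X ≥ 25`, `3 ≤ V ≤ T/8`, `T ≥ 8`, `0 < η ≤ 1`, and a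
uniform bound `B ≥ V` for the Gaussian critical-line mean squares
`∫ |G_{X,T₀,V}(1/2+iy)|² dy ≤ B` at all centres `T₀ ∈ [T/2, 3T]`. Then for every finite set `Z` of zeros
with `β ≥ 1/2 + η`, `T/2 < γ ≤ 5T/2`,
`∑_Z m ≤ ⌈2T/(V−1)⌉ (πη)⁻¹ {(44 V B)^{1/2} (25/X)^{η/20} + 8V X^{-1/2} + 5π(15(log 10 + 4 log(3T+13) + log X)+1) + 5π/2}`.
[cite: Titchmarsh1986, §9.19] -/
theorem level_sum_le {X T V B η : ℝ} (hX : 25 ≤ X) (hV : 3 ≤ V) (hVT : V ≤ T / 8) (hη : 0 < η) (hη1 : η ≤ 1)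
    (hB : V ≤ B)
    (hmean : ∀ T₀ : ℝ, T / 2 ≤ T₀ → T₀ ≤ 3 * T →
      ∫ y : ℝ, ‖zetaMollifierG X T₀ V ((1 / 2 : ℝ) + y * I)‖ ^ 2 ≤ B)
    (Z : Finset ℂ) (hZ : ∀ ρ ∈ Z, riemannZeta ρ = 0 ∧ 1 / 2 + η ≤ ρ.re ∧ T / 2 < ρ.im ∧ ρ.im ≤ 5 * T / 2) :
    ∑ ρ ∈ Z, (riemannZetaZeroOrder ρ : ℝ) ≤
      (⌈2 * T / (V - 1)⌉₊ : ℝ) * ((1 / (π * η)) * (Real.sqrt (44 * V * B) * (25 / X) ^ (η / 20)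
        + 8 * V * X ^ (-(1 / 2 : ℝ))
        + 5 * (π * (15 * (Real.log 10 + 4 * Real.log (3 * T + 13) + Real.log X) + 1)) + 5 / 2 * π)) := by
  have hT : 24 ≤ T := by linarith
  have hV' : 0 < V - 1 := by linarith
  have hX0 : 0 < X := by linarith
  refine sum_le_of_blocks (V' := V - 1) hV' (P := fun ρ => riemannZeta ρ = 0 ∧ 1 / 2 + η ≤ ρ.re)
    (m := fun ρ => (riemannZetaZeroOrder ρ : ℝ)) ?_ Z (fun ρ hρ => ⟨⟨(hZ ρ hρ).1, (hZ ρ hρ).2.1⟩, (hZ ρ hρ).2.2⟩)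
  intro j hj1 hjJ Z₀ hZ₀
  -- the block
  set T₀ := T / 2 + (j : ℝ) * (V - 1) with hT₀
  set c := T / 2 + ((j : ℝ) - 1) * (V - 1) with hc
  set d := T / 2 + ((j : ℝ) + 1) * (V - 1) with hd
  have hj1' : (1 : ℝ) ≤ j := by exact_mod_cast hj1
  have hJle : (⌈2 * T / (V - 1)⌉₊ : ℝ) < 2 * T / (V - 1) + 1 := Nat.ceil_lt_add_one (by positivity)
  have hjV : (j : ℝ) * (V - 1) ≤ 2 * T + (V - 1) := by
    have : (j : ℝ) ≤ 2 * T / (V - 1) + 1 := by linarith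
    have := mul_le_mul_of_nonneg_right this hV'.le
    rwa [add_mul, div_mul_cancel₀ _ hV'.ne', one_mul] at this
  have hT₀lo : T / 2 ≤ T₀ := by rw [hT₀]; nlinarith
  have hT₀hi : T₀ ≤ 3 * T := by rw [hT₀]; linarith
  have hc4 : 4 ≤ c := by rw [hc]; nlinarith
  have hcd : c ≤ d := by rw [hc, hd]; nlinarith
  have hcV : T₀ - V ≤ c - 1 := by rw [hT₀, hc]; linarith
  have hdV : d + 1 ≤ T₀ + V := by rw [hT₀, hd]; linarith
  have hd3T : d ≤ 3 * T := by rw [hd]; nlinarith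
  have hZ₀' : ∀ ρ ∈ Z₀, riemannZeta ρ = 0 ∧ 1 / 2 + η ≤ ρ.re ∧ c < ρ.im ∧ ρ.im < d := fun ρ hρ =>
    ⟨(hZ₀ ρ hρ).1.1, (hZ₀ ρ hρ).1.2, (hZ₀ ρ hρ).2.1, (hZ₀ ρ hρ).2.2⟩
  have h := sum_zetaZeroOrder_le_of_meanSquare hX hV hc4 hcd hcV hdV hη hη1 (hmean T₀ hT₀lo hT₀hi) hB Z₀ hZ₀'
  refine h.trans ?_
  have hdc : d - c + 2 = 2 * V := by rw [hc, hd]; ring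
  rw [hdc]
  have hπη : 0 < 1 / (π * η) := by positivity
  refine mul_le_mul_of_nonneg_left ?_ hπη.le
  have hB0 : 0 ≤ B := by linarith
  -- `√(22 (B (25/X)^{η/10}) (2V)) = √(44 V B) (25/X)^{η/20}`
  have hsq : Real.sqrt (22 * (B * (25 / X) ^ (η / 10)) * (2 * V)) = Real.sqrt (44 * V * B) * (25 / X) ^ (η / 20) := by
    have h25 : (0 : ℝ) ≤ 25 / X := by positivity
    have e1 : 22 * (B * (25 / X) ^ (η / 10)) * (2 * V) = (44 * V * B) * (25 / X) ^ (η / 10) := by ring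
    rw [e1, Real.sqrt_mul (by positivity)]
    congr 1
    rw [Real.sqrt_eq_rpow, ← Real.rpow_mul h25]
    congr 1; ring
  rw [hsq]
  have hlog : Real.log (d + 13) ≤ Real.log (3 * T + 13) := Real.log_le_log (by linarith) (by linarith)
  have hlog0 : 0 ≤ Real.log 10 := Real.log_nonneg (by norm_num)
  nlinarith [Real.pi_pos, hlog]

/-! ### The near sum: explicit bound -/

/-- `∑_{a ∈ [1, A]} e^{(a+1)/(4M'')} q^a ≤ e^{1/(4M'')}/(1 − r)` with `r = e^{1/(4M'')} q < 1`, `q ≥ 0`. [folklore] -/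
theorem sum_exp_mul_pow_le {M'' q : ℝ} (hM : 0 < M'') (hq : 0 ≤ q) (hr : Real.exp (1 / (4 * M'')) * q < 1) (A : ℕ) :
    ∑ a ∈ Finset.Icc 1 A, Real.exp (((a : ℝ) + 1) / (4 * M'')) * q ^ a ≤
      Real.exp (1 / (4 * M'')) / (1 - Real.exp (1 / (4 * M'')) * q) := by
  set r := Real.exp (1 / (4 * M'')) * q with hr'
  have hr0 : 0 ≤ r := by positivity
  have heq : ∀ a : ℕ, Real.exp (((a : ℝ) + 1) / (4 * M'')) * q ^ a = Real.exp (1 / (4 * M'')) * r ^ a := by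
    intro a
    rw [hr', mul_pow, ← Real.exp_nat_mul, ← mul_assoc, ← Real.exp_add]
    congr 1; · congr 1; field_simp; ring
  simp_rw [heq, ← Finset.mul_sum]
  have hgeom := geom_sum_Ico_le_of_lt_one (m := 1) (n := A + 1) hr0 hr
  rw [pow_one] at hgeom
  have hIco : Finset.Ico 1 (A + 1) = Finset.Icc 1 A := by ext a; simp
  rw [hIco] at hgeom
  have h1r : 0 < 1 - r := by linarith
  calc Real.exp (1 / (4 * M'')) * ∑ i ∈ Finset.Icc 1 A, r ^ i ≤ Real.exp (1 / (4 * M'')) * (r / (1 - r)) :=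
        mul_le_mul_of_nonneg_left hgeom (Real.exp_pos _).le
    _ ≤ Real.exp (1 / (4 * M'')) * (1 / (1 - r)) :=
        mul_le_mul_of_nonneg_left (div_le_div_of_nonneg_right hr.le h1r.le) (Real.exp_pos _).le
    _ = Real.exp (1 / (4 * M'')) / (1 - r) := by ring

/-- `∑_{a ∈ [1, A]} ((a+1)/a) e^{(a+1)/(4M'')} ≤ 2 A e^{(A+1)/(4M'')}`. [folklore] -/
theorem sum_exp_le {M'' : ℝ} (hM : 0 < M'') (A : ℕ) :
    ∑ a ∈ Finset.Icc 1 A, ((a : ℝ) + 1) / a * Real.exp (((a : ℝ) + 1) / (4 * M'')) ≤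
      2 * A * Real.exp (((A : ℝ) + 1) / (4 * M'')) := by
  calc ∑ a ∈ Finset.Icc 1 A, ((a : ℝ) + 1) / a * Real.exp (((a : ℝ) + 1) / (4 * M''))
      ≤ ∑ a ∈ Finset.Icc 1 A, 2 * Real.exp (((A : ℝ) + 1) / (4 * M'')) := by
        refine Finset.sum_le_sum fun a ha => ?_
        rw [Finset.mem_Icc] at ha
        have ha1 : (1 : ℝ) ≤ a := by exact_mod_cast ha.1
        have haA : (a : ℝ) ≤ A := by exact_mod_cast ha.2
        have h1 : ((a : ℝ) + 1) / a ≤ 2 := by rw [div_le_iff₀ (by linarith)]; linarith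
        have h2 : Real.exp (((a : ℝ) + 1) / (4 * M'')) ≤ Real.exp (((A : ℝ) + 1) / (4 * M'')) :=
          Real.exp_le_exp.2 (div_le_div_of_nonneg_right (by linarith) (by positivity))
        exact mul_le_mul h1 h2 (Real.exp_pos _).le (by norm_num)
    _ = 2 * A * Real.exp (((A : ℝ) + 1) / (4 * M'')) := by
        rw [Finset.sum_const, Nat.card_Icc, nsmul_eq_mul]; simp; ring

/-- **The near sum, explicit form.** With the local-count constant `C_w`, parameters `X ≥ 25`,
`3 ≤ V ≤ T/8`, `L > 0`, `M'' > 0`, `τ ≤ L/M''`, a uniform Gaussian mean-square bound `B ≥ V` at the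
centres `T₀ ∈ [T/2, 3T]`, and `r = e^{1/(4M'')} (25/X)^{1/(20L)} < 1`: for the finite set `F` of the
zeros with `T/2 < γ ≤ 5T/2`,
`∑_F m δ e^{τδ/4} ≤ e^{1/(4M'')} C_w (2T+3) log(5T/2+3)/L + (4J/π) {√(44VB) e^{1/(4M'')}/(1−r) + R L e^{(L/2+1)/(4M'')}}`,
`J = ⌈2T/(V−1)⌉`, `R = 8V X^{-1/2} + 5π(15(log 10 + 4 log(3T+13) + log X)+1) + 5π/2`.
[cite: Titchmarsh1986, §9.26] -/
theorem nearSum_le_explicit {C : ℝ}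
    (hC : ∀ (c : ℝ) (F : Finset ℂ), (∀ ρ ∈ F, ρ ∈ ZetaZeros.riemannZetaNontrivialZeros ∧ |ρ.im - c| ≤ 1 / 2) →
      ∑ ρ ∈ F, (riemannZetaZeroOrder ρ : ℝ) ≤ C * Real.log (|c| + 2))
    {X T V B Lg M'' τ : ℝ} (hX : 25 ≤ X) (hV : 3 ≤ V) (hVT : V ≤ T / 8) (hL : 2 ≤ Lg) (hM : 0 < M'')
    (hτ : τ ≤ Lg / M'') (hB : V ≤ B)
    (hmean : ∀ T₀ : ℝ, T / 2 ≤ T₀ → T₀ ≤ 3 * T →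
      ∫ y : ℝ, ‖zetaMollifierG X T₀ V ((1 / 2 : ℝ) + y * I)‖ ^ 2 ≤ B)
    (hr : Real.exp (1 / (4 * M'')) * (25 / X) ^ (1 / (20 * Lg)) < 1)
    (F : Finset ℂ) (hF : ∀ ρ ∈ F, riemannZeta ρ = 0 ∧ 0 < ρ.re ∧ ρ.re < 1 ∧ T / 2 < ρ.im ∧ ρ.im ≤ 5 * T / 2) :
    ∑ ρ ∈ F, (riemannZetaZeroOrder ρ : ℝ) * (|ρ.re - 1 / 2| * Real.exp (τ * |ρ.re - 1 / 2| / 4)) ≤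
      Real.exp (1 / (4 * M'')) * (C * ((2 * T + 3) * Real.log (5 * T / 2 + 3))) / Lg +
      4 * (⌈2 * T / (V - 1)⌉₊ : ℝ) / π *
        (Real.sqrt (44 * V * B) * (Real.exp (1 / (4 * M'')) / (1 - Real.exp (1 / (4 * M'')) * (25 / X) ^ (1 / (20 * Lg)))) +
          (8 * V * X ^ (-(1 / 2 : ℝ)) + 5 * (π * (15 * (Real.log 10 + 4 * Real.log (3 * T + 13) + Real.log X) + 1)) + 5 / 2 * π) *
            (Lg * Real.exp (((⌊Lg / 2⌋₊ : ℝ) + 1) / (4 * M'')))) := by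
  have hT : 24 ≤ T := by linarith
  have hX0 : 0 < X := by linarith
  have hL0 : 0 < Lg := by linarith
  set J : ℝ := (⌈2 * T / (V - 1)⌉₊ : ℝ) with hJ
  set P := Real.sqrt (44 * V * B) with hP
  set Rr := 8 * V * X ^ (-(1 / 2 : ℝ)) + 5 * (π * (15 * (Real.log 10 + 4 * Real.log (3 * T + 13) + Real.log X) + 1)) + 5 / 2 * π
    with hRr
  set q := (25 / X) ^ (1 / (20 * Lg)) with hq
  have hq0 : 0 ≤ q := by rw [hq]; positivity
  have hlog0 : 0 ≤ Real.log 10 := Real.log_nonneg (by norm_num)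
  have hlog3T : 0 ≤ Real.log (3 * T + 13) := Real.log_nonneg (by linarith)
  have hlogX : 0 ≤ Real.log X := Real.log_nonneg (by linarith)
  have hR0 : 0 ≤ Rr := by rw [hRr]; positivity
  have hP0 : 0 ≤ P := Real.sqrt_nonneg _
  have hJ0 : 0 ≤ J := by rw [hJ]; positivity
  -- the density function on the levels
  set D : ℕ → ℝ := fun a => J * ((1 / (π * ((a : ℝ) / Lg))) * (P * (25 / X) ^ (((a : ℝ) / Lg) / 20) + Rr)) with hD
  have hDa : ∀ a : ℕ, 1 ≤ a → ∀ Z : Finset ℂ,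
      (∀ ρ ∈ Z, riemannZeta ρ = 0 ∧ 1 / 2 + (a : ℝ) / Lg ≤ ρ.re ∧ T / 2 < ρ.im ∧ ρ.im ≤ 5 * T / 2) →
      ∑ ρ ∈ Z, (riemannZetaZeroOrder ρ : ℝ) ≤ D a := by
    intro a ha Z hZ
    have ha1 : (1 : ℝ) ≤ a := by exact_mod_cast ha
    have hη : 0 < (a : ℝ) / Lg := by positivity
    -- `a/L ≤ 1`: otherwise `Z` is empty (`β < 1`), and the bound is non-negative anyway; we split
    by_cases hη1 : (a : ℝ) / Lg ≤ 1
    · have := level_sum_le hX hV hVT hη hη1 hB hmean Z hZ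
      refine this.trans (le_of_eq ?_)
      simp only [hD, hJ, hP, hRr]; ring
    · have hZe : ∀ ρ ∈ Z, False := by
        intro ρ hρ
        obtain ⟨hz, hβ, -, -⟩ := hZ ρ hρ
        have := re_lt_one_of_riemannZeta_eq_zero hz
        push Not at hη1; linarith
      have : ∑ ρ ∈ Z, (riemannZetaZeroOrder ρ : ℝ) = 0 := Finset.sum_eq_zero fun ρ hρ => (hZe ρ hρ).elim
      rw [this, hD]; positivity
  have hN₀ := sum_near_le hC (by linarith) F hF
  have hmain := nearSum_le_of_density (D := D) hL0 hM hτ F hF hN₀ hDa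
  refine hmain.trans (add_le_add le_rfl ?_)
  -- sum over the levels
  have hterm : ∀ a ∈ Finset.Icc 1 ⌊Lg / 2⌋₊, ((a : ℝ) + 1) / Lg * Real.exp (((a : ℝ) + 1) / (4 * M'')) * D a =
      (J / π) * ((((a : ℝ) + 1) / a) * Real.exp (((a : ℝ) + 1) / (4 * M'')) * (P * q ^ a + Rr)) := by
    intro a ha
    rw [Finset.mem_Icc] at ha
    have ha0 : (a : ℝ) ≠ 0 := Nat.cast_ne_zero.2 (by omega)
    have hqa : (25 / X) ^ (((a : ℝ) / Lg) / 20) = q ^ a := by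
      rw [hq, ← Real.rpow_natCast, ← Real.rpow_mul (by positivity)]
      congr 1; field_simp
    simp only [hD, hqa]
    field_simp
  rw [Finset.sum_congr rfl hterm, ← Finset.mul_sum]
  have hsum1 : ∑ a ∈ Finset.Icc 1 ⌊Lg / 2⌋₊, (((a : ℝ) + 1) / a) * Real.exp (((a : ℝ) + 1) / (4 * M'')) * (P * q ^ a + Rr) ≤
      2 * (P * (Real.exp (1 / (4 * M'')) / (1 - Real.exp (1 / (4 * M'')) * q))) +
        Rr * (2 * ⌊Lg / 2⌋₊ * Real.exp (((⌊Lg / 2⌋₊ : ℝ) + 1) / (4 * M''))) := by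
    have hsplit : ∀ a ∈ Finset.Icc 1 ⌊Lg / 2⌋₊, (((a : ℝ) + 1) / a) * Real.exp (((a : ℝ) + 1) / (4 * M'')) * (P * q ^ a + Rr) ≤
        2 * (P * (Real.exp (((a : ℝ) + 1) / (4 * M'')) * q ^ a)) + Rr * ((((a : ℝ) + 1) / a) * Real.exp (((a : ℝ) + 1) / (4 * M''))) := by
      intro a ha
      rw [Finset.mem_Icc] at ha
      have ha1 : (1 : ℝ) ≤ a := by exact_mod_cast ha.1
      have h1 : ((a : ℝ) + 1) / a ≤ 2 := by rw [div_le_iff₀ (by linarith)]; linarith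
      have h10 : 0 ≤ ((a : ℝ) + 1) / a := by positivity
      have he : 0 ≤ Real.exp (((a : ℝ) + 1) / (4 * M'')) * q ^ a := by positivity
      nlinarith [mul_le_mul_of_nonneg_right h1 (mul_nonneg hP0 he)]
    refine (Finset.sum_le_sum hsplit).trans ?_
    rw [Finset.sum_add_distrib, ← Finset.mul_sum, ← Finset.mul_sum, ← Finset.mul_sum]
    refine add_le_add ?_ ?_
    · exact mul_le_mul_of_nonneg_left (mul_le_mul_of_nonneg_left (sum_exp_mul_pow_le hM hq0 hr _) hP0) (by norm_num)
    · exact mul_le_mul_of_nonneg_left (sum_exp_le hM _) hR0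
  have hfloor : (⌊Lg / 2⌋₊ : ℝ) ≤ Lg / 2 := Nat.floor_le (by positivity)
  have hJπ : 0 ≤ J / π := by positivity
  calc 2 * (J / π * ∑ a ∈ Finset.Icc 1 ⌊Lg / 2⌋₊, (((a : ℝ) + 1) / a) * Real.exp (((a : ℝ) + 1) / (4 * M'')) * (P * q ^ a + Rr))
      ≤ 2 * (J / π * (2 * (P * (Real.exp (1 / (4 * M'')) / (1 - Real.exp (1 / (4 * M'')) * q))) +
          Rr * (2 * ⌊Lg / 2⌋₊ * Real.exp (((⌊Lg / 2⌋₊ : ℝ) + 1) / (4 * M''))))) := by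
        exact mul_le_mul_of_nonneg_left (mul_le_mul_of_nonneg_left hsum1 hJπ) (by norm_num)
    _ ≤ 4 * J / π * (P * (Real.exp (1 / (4 * M'')) / (1 - Real.exp (1 / (4 * M'')) * q)) +
          Rr * (Lg * Real.exp (((⌊Lg / 2⌋₊ : ℝ) + 1) / (4 * M'')))) := by
        have he0 : 0 ≤ Real.exp (((⌊Lg / 2⌋₊ : ℝ) + 1) / (4 * M'')) := (Real.exp_pos _).le
        have h2 : 2 * (⌊Lg / 2⌋₊ : ℝ) ≤ Lg := by linarith
        have h3 : Rr * (2 * ⌊Lg / 2⌋₊ * Real.exp (((⌊Lg / 2⌋₊ : ℝ) + 1) / (4 * M''))) ≤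
            Rr * (Lg * Real.exp (((⌊Lg / 2⌋₊ : ℝ) + 1) / (4 * M''))) :=
          mul_le_mul_of_nonneg_left (mul_le_mul_of_nonneg_right h2 he0) hR0
        have h1r : 0 < 1 - Real.exp (1 / (4 * M'')) * q := by linarith
        have h4 : 0 ≤ P * (Real.exp (1 / (4 * M'')) / (1 - Real.exp (1 / (4 * M'')) * q)) := by positivity
        have h5 : 0 ≤ Rr * (Lg * Real.exp (((⌊Lg / 2⌋₊ : ℝ) + 1) / (4 * M''))) := by positivity
        calc 2 * (J / π * (2 * (P * (Real.exp (1 / (4 * M'')) / (1 - Real.exp (1 / (4 * M'')) * q))) +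
              Rr * (2 * ⌊Lg / 2⌋₊ * Real.exp (((⌊Lg / 2⌋₊ : ℝ) + 1) / (4 * M'')))))
            ≤ 2 * (J / π * (2 * (P * (Real.exp (1 / (4 * M'')) / (1 - Real.exp (1 / (4 * M'')) * q))) +
              Rr * (Lg * Real.exp (((⌊Lg / 2⌋₊ : ℝ) + 1) / (4 * M''))))) :=
              mul_le_mul_of_nonneg_left (mul_le_mul_of_nonneg_left (by linarith) hJπ) (by norm_num)
          _ ≤ _ := by
              have e : 4 * J / π * (P * (Real.exp (1 / (4 * M'')) / (1 - Real.exp (1 / (4 * M'')) * q)) +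
                    Rr * (Lg * Real.exp (((⌊Lg / 2⌋₊ : ℝ) + 1) / (4 * M'')))) -
                  2 * (J / π * (2 * (P * (Real.exp (1 / (4 * M'')) / (1 - Real.exp (1 / (4 * M'')) * q))) +
                    Rr * (Lg * Real.exp (((⌊Lg / 2⌋₊ : ℝ) + 1) / (4 * M''))))) =
                  2 * (J / π * (Rr * (Lg * Real.exp (((⌊Lg / 2⌋₊ : ℝ) + 1) / (4 * M''))))) := by ring
              have := mul_nonneg hJπ h5
              linarith

end Literature.NumberTheory.LFunctions.SelbergDelta
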